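import Mathlib

/-!
# PercRepro — (SP): THE PUNCTURED-LEVEL LYM INEQUALITY — THE WEIGHTED-HALL MASTER LEMMA AND (SP) FOR REGULAR CODES
(p10, gen 30)

Vocabulary (gen 29's §8).  A CODE is a family `D` of `j`-subsets of a finite type `α` with pairwise intersections of size
`≤ j − 2` (no two members lie in a common `(j+1)`-set); `P = C(α, j) ∖ D` is the PUNCTURED level, `Y = C(α, j+1)` the level
above, `N(𝒜) = {Y ∈ Y : Y ⊇ some X ∈ 𝒜}` the up-shadow of a family `𝒜 ⊆ P`.

**CONJECTURE (SP)** (`SP`, NOT asserted): for every code, `#N(𝒜) · #P ≥ #𝒜 · #Y` for every `𝒜 ⊆ P` — the normalised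
matching property between the punctured level and the level above.  (SP) is the bottom step of (NC) for every sparse
paving matroid with `n ≤ 2r − 2` (gen 29 §8) and (NMP-I) at the top two levels of such a matroid.  DATA (own exact code,
work/sp/, C Dinic max-flow = the Hall condition, planted control fires): 0 failures on ALL codes with `n ≤ 8` at every `j`
(244,761 dihedral-lex-min representatives at `(8,4)`), on all codes at `(9,3)` and `(9,6)`, on 1,564 instances derived from
the Steiner systems `S(2,3,7)`, `S(3,4,8)`, `S(2,3,9)`, `S(2,3,13)`, `S(2,4,13)`, `S(2,3,15)`, `S(3,4,10)`, `S(4,5,11)`,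
`S(5,6,12)` and on 236 random codes with `n ≤ 14`.

THIS FILE (all unconditional):
* `card_upNbhd_ge_of_weights` — THE MASTER LEMMA (weighted Hall): weights `w ≥ 0` on the inclusion pairs `X ⊂ Y` with row
  sums `≥ r` on `P` and column sums `≤ 1` on `Y` give `#𝒜 · r ≤ #N(𝒜)` for every `𝒜 ⊆ P`;
* `code_unique_of_subset`, `card_subsP`, `sum_sups`, `card_sups` — a `(j+1)`-set contains at most one code word, so it
  has `j + 1` subsets in `P` when untouched and `j` when touched; the supersets of a `j`-set `X` are the `insert y X`,
  `y ∉ X`; `touchedCount D X` counts the touched ones (`= t(X)`);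
* `puncturedNMP_of_regular` — **(SP) holds for every REGULAR code** (every `X ∈ P` has the same number `t₀` of touched
  supersets): the weights `1/j` on touched and `1/(j+1)` on untouched pairs have column sums exactly `1` and constant row
  sums, which are then `#Y / #P` by double counting;
* `puncturedNMP_empty` — the classical normalised matching property (LYM) between consecutive levels (`D = ∅`, `t₀ = 0`).
The Steiner-system case (`t₀ = j`) is PuncturedLYMSteiner; the potential-coupling reduction is PuncturedLYMPotential.
Nothing here asserts (SP).
-/

namespace PercRepro.PuncturedLYM

open Finset

variable {α : Type} [Fintype α] [DecidableEq α]

/-! ### The objects -/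

/-- A code of `j`-sets: every member has `j` elements and two distinct members meet in at most `j − 2` elements. -/
def IsCode (j : ℕ) (D : Finset (Finset α)) : Prop :=
  (∀ B ∈ D, B.card = j) ∧ ∀ B ∈ D, ∀ B' ∈ D, B ≠ B' → (B ∩ B').card + 2 ≤ j

/-- The punctured level `P = C(α, j) ∖ D`. -/
def punctured (j : ℕ) (D : Finset (Finset α)) : Finset (Finset α) :=
  (univ : Finset α).powersetCard j \ D

/-- The level above, `Y = C(α, j + 1)`. -/
def levelAbove (α : Type) [Fintype α] (j : ℕ) : Finset (Finset α) :=
  (univ : Finset α).powersetCard (j + 1)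

/-- The up-shadow `N(𝒜)` of a family `𝒜` inside the level above. -/
def upNbhd (j : ℕ) (𝒜 : Finset (Finset α)) : Finset (Finset α) :=
  (levelAbove α j).filter (fun Y => ∃ X ∈ 𝒜, X ⊆ Y)

/-- The supersets of `X` in the level above. -/
def sups (j : ℕ) (X : Finset α) : Finset (Finset α) :=
  (levelAbove α j).filter (fun Y => X ⊆ Y)

/-- The subsets of `Y` in the punctured level. -/
def subsP (j : ℕ) (D : Finset (Finset α)) (Y : Finset α) : Finset (Finset α) :=
  (punctured j D).filter (fun X => X ⊆ Y)

/-- **(SP) for one code** (the normalised matching property of `P` against `Y`): `#𝒜 · #Y ≤ #N(𝒜) · #P` for every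
`𝒜 ⊆ P`. -/
def PuncturedNMP (j : ℕ) (D : Finset (Finset α)) : Prop :=
  ∀ 𝒜 ⊆ punctured j D, 𝒜.card * (levelAbove α j).card ≤ (upNbhd j 𝒜).card * (punctured j D).card

/-- **CONJECTURE (SP) (NOT asserted)**: every code on every finite type has the punctured normalised matching property. -/
def SP : Prop :=
  ∀ (α : Type) [Fintype α] [DecidableEq α] (j : ℕ) (D : Finset (Finset α)), IsCode j D → PuncturedNMP j D

/-! ### Elementary membership facts -/

/-- Membership in the punctured level. -/
theorem mem_punctured {j : ℕ} {D : Finset (Finset α)} {X : Finset α} :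
    X ∈ punctured j D ↔ X.card = j ∧ X ∉ D := by
  simp [punctured, mem_powersetCard]

omit [DecidableEq α] in
/-- Membership in the level above. -/
theorem mem_levelAbove {j : ℕ} {Y : Finset α} : Y ∈ levelAbove α j ↔ Y.card = j + 1 := by
  simp [levelAbove, mem_powersetCard]

/-- Membership in the up-shadow. -/
theorem mem_upNbhd {j : ℕ} {𝒜 : Finset (Finset α)} {Y : Finset α} :
    Y ∈ upNbhd j 𝒜 ↔ Y.card = j + 1 ∧ ∃ X ∈ 𝒜, X ⊆ Y := by
  simp [upNbhd, mem_levelAbove]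

/-- Membership in the supersets of `X`. -/
theorem mem_sups {j : ℕ} {X Y : Finset α} : Y ∈ sups j X ↔ Y.card = j + 1 ∧ X ⊆ Y := by
  simp [sups, mem_levelAbove]

/-- Membership in the `P`-subsets of `Y`. -/
theorem mem_subsP {j : ℕ} {D : Finset (Finset α)} {X Y : Finset α} :
    X ∈ subsP j D Y ↔ (X.card = j ∧ X ∉ D) ∧ X ⊆ Y := by
  simp [subsP, mem_punctured]

/-! ### The master lemma: weighted Hall -/

/-- **Weighted Hall.** Nonnegative weights on the inclusion pairs `X ⊂ Y` (`X ∈ P`, `Y ∈ Y`) with row sums `≥ r` at every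
`X ∈ P` and column sums `≤ 1` at every `Y` give `#𝒜 · r ≤ #N(𝒜)` for every family `𝒜 ⊆ P`. -/
theorem card_upNbhd_ge_of_weights {j : ℕ} {D : Finset (Finset α)} (w : Finset α → Finset α → ℚ) (r : ℚ)
    (hw : ∀ X Y, 0 ≤ w X Y)
    (hrow : ∀ X ∈ punctured j D, r ≤ ∑ Y ∈ sups j X, w X Y)
    (hcol : ∀ Y ∈ levelAbove α j, ∑ X ∈ subsP j D Y, w X Y ≤ 1)
    {𝒜 : Finset (Finset α)} (h𝒜 : 𝒜 ⊆ punctured j D) :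
    (𝒜.card : ℚ) * r ≤ (upNbhd j 𝒜).card := by
  -- step 1: `#𝒜 · r ≤ Σ_{X ∈ 𝒜} Σ_{Y ⊃ X} w X Y`
  have h1 : (𝒜.card : ℚ) * r ≤ ∑ X ∈ 𝒜, ∑ Y ∈ sups j X, w X Y := by
    rw [card_eq_sum_ones, Nat.cast_sum, sum_mul]
    apply sum_le_sum
    intro X hX
    simpa using hrow X (h𝒜 hX)
  -- step 2: swap the sums: every superset of a member of `𝒜` lies in `N(𝒜)`
  have h2 : ∑ X ∈ 𝒜, ∑ Y ∈ sups j X, w X Y = ∑ Y ∈ upNbhd j 𝒜, ∑ X ∈ 𝒜.filter (fun X => X ⊆ Y), w X Y := by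
    apply sum_comm'
    intro X Y
    simp only [mem_sups, mem_upNbhd, mem_filter]
    constructor
    · rintro ⟨hX, hY, hXY⟩
      exact ⟨⟨hX, hXY⟩, hY, X, hX, hXY⟩
    · rintro ⟨⟨hX, hXY⟩, hY, -⟩
      exact ⟨hX, hY, hXY⟩
  -- step 3: enlarge the inner sums to all of `P ∩ 2^Y` and use the column bound
  have h3 : ∑ Y ∈ upNbhd j 𝒜, ∑ X ∈ 𝒜.filter (fun X => X ⊆ Y), w X Y ≤ ∑ Y ∈ upNbhd j 𝒜, (1 : ℚ) := by
    apply sum_le_sum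
    intro Y hY
    have hY' : Y ∈ levelAbove α j := (mem_filter.1 hY).1
    calc ∑ X ∈ 𝒜.filter (fun X => X ⊆ Y), w X Y ≤ ∑ X ∈ subsP j D Y, w X Y := by
          apply sum_le_sum_of_subset_of_nonneg
          · intro X hX
            rw [mem_filter] at hX
            exact mem_filter.2 ⟨h𝒜 hX.1, hX.2⟩
          · intro X _ _
            exact hw X Y
      _ ≤ 1 := hcol Y hY'
  calc (𝒜.card : ℚ) * r ≤ ∑ X ∈ 𝒜, ∑ Y ∈ sups j X, w X Y := h1
    _ = ∑ Y ∈ upNbhd j 𝒜, ∑ X ∈ 𝒜.filter (fun X => X ⊆ Y), w X Y := h2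
    _ ≤ ∑ Y ∈ upNbhd j 𝒜, (1 : ℚ) := h3
    _ = (upNbhd j 𝒜).card := by simp

/-! ### Touched sets, the subsets of a `(j+1)`-set in `P`, the supersets of a `j`-set -/

/-- `Y` is TOUCHED when it contains a code word (an abbreviation, so that it is decidable by the bounded existential
over the finite family `D`). -/
abbrev Touched (D : Finset (Finset α)) (Y : Finset α) : Prop := ∃ B ∈ D, B ⊆ Y

omit [Fintype α] in
/-- Two `j`-subsets of a `(j+1)`-set meet in at least `j − 1` elements. -/
theorem card_inter_add_one_ge {j : ℕ} {B B' Y : Finset α} (hB : B.card = j) (hB' : B'.card = j) (hY : Y.card = j + 1)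
    (hBY : B ⊆ Y) (hB'Y : B' ⊆ Y) : j ≤ (B ∩ B').card + 1 := by
  have h1 : (B ∪ B').card ≤ j + 1 := hY ▸ card_le_card (union_subset hBY hB'Y)
  have h2 := card_union_add_card_inter B B'
  omega

omit [Fintype α] in
/-- A `(j+1)`-set contains at most one code word. -/
theorem code_unique_of_subset {j : ℕ} {D : Finset (Finset α)} (hD : IsCode j D) {B B' Y : Finset α} (hB : B ∈ D)
    (hB' : B' ∈ D) (hY : Y.card = j + 1) (hBY : B ⊆ Y) (hB'Y : B' ⊆ Y) : B = B' := by
  by_contra hne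
  have h1 := card_inter_add_one_ge (hD.1 B hB) (hD.1 B' hB') hY hBY hB'Y
  have h2 := hD.2 B hB B' hB' hne
  omega

/-- The subsets of `Y` in `P` are the `j`-subsets of `Y` outside `D`. -/
theorem subsP_eq {j : ℕ} {D : Finset (Finset α)} (Y : Finset α) :
    subsP j D Y = (Y.powersetCard j).filter (fun X => X ∉ D) := by
  ext X
  simp only [mem_subsP, mem_filter, mem_powersetCard]
  tauto

omit [Fintype α] in
/-- The number of code words inside a `(j+1)`-set is `1` if it is touched and `0` otherwise. -/
theorem card_filter_mem_code {j : ℕ} {D : Finset (Finset α)} (hD : IsCode j D) {Y : Finset α} (hY : Y.card = j + 1) :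
    ((Y.powersetCard j).filter (fun X => X ∈ D)).card = if Touched D Y then 1 else 0 := by
  have hsub : ((Y.powersetCard j).filter (fun X => X ∈ D)).card ≤ 1 := by
    rw [card_le_one]
    intro B hB B' hB'
    rw [mem_filter, mem_powersetCard] at hB hB'
    exact code_unique_of_subset hD hB.2 hB'.2 hY hB.1.1 hB'.1.1
  split_ifs with ht
  · obtain ⟨B, hBD, hBY⟩ := ht
    have hmem : B ∈ (Y.powersetCard j).filter (fun X => X ∈ D) := by
      rw [mem_filter, mem_powersetCard]
      exact ⟨⟨hBY, hD.1 B hBD⟩, hBD⟩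
    have hpos : 0 < ((Y.powersetCard j).filter (fun X => X ∈ D)).card := card_pos.2 ⟨B, hmem⟩
    omega
  · rw [card_eq_zero, filter_eq_empty_iff]
    intro B hB hBD
    rw [mem_powersetCard] at hB
    exact ht ⟨B, hBD, hB.1⟩

/-- A `(j+1)`-set has `j + 1` subsets in `P` when untouched and `j` when touched. -/
theorem card_subsP {j : ℕ} {D : Finset (Finset α)} (hD : IsCode j D) {Y : Finset α} (hY : Y.card = j + 1) :
    (subsP j D Y).card + (if Touched D Y then 1 else 0) = j + 1 := by
  rw [subsP_eq, ← card_filter_mem_code hD hY, add_comm, card_filter_add_card_filter_not, card_powersetCard, hY,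
    Nat.choose_succ_self_right]

/-- The supersets of a `j`-set `X` in the level above are the sets `insert y X`, `y ∉ X`. -/
theorem sups_eq {j : ℕ} {X : Finset α} (hX : X.card = j) :
    sups j X = (univ \ X).image (fun y => insert y X) := by
  ext Y
  simp only [mem_sups, mem_image, mem_sdiff, mem_univ, true_and]
  constructor
  · rintro ⟨hY, hXY⟩
    have hne : (Y \ X).Nonempty := by
      rw [← card_pos, card_sdiff_of_subset hXY, hY, hX]
      omega
    obtain ⟨y, hy⟩ := hne
    rw [mem_sdiff] at hy
    refine ⟨y, hy.2, ?_⟩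
    apply eq_of_subset_of_card_le
    · exact insert_subset hy.1 hXY
    · rw [card_insert_of_notMem hy.2, hX, hY]
  · rintro ⟨y, hy, rfl⟩
    exact ⟨by rw [card_insert_of_notMem hy, hX], subset_insert y X⟩

/-- `y ↦ insert y X` is injective off `X`. -/
theorem insert_injOn (X : Finset α) : Set.InjOn (fun y => insert y X) ((univ : Finset α) \ X : Finset α) := by
  intro y hy y' hy' h
  simp only [coe_sdiff, coe_univ, Set.mem_sdiff, Set.mem_univ, true_and, mem_coe] at hy hy'
  have h' : insert y X = insert y' X := h
  have : y ∈ insert y' X := h' ▸ mem_insert_self y X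
  rw [mem_insert] at this
  rcases this with h' | h'
  · exact h'
  · exact absurd h' hy

/-- Sums over the supersets of a `j`-set are sums over the outside points. -/
theorem sum_sups {j : ℕ} {X : Finset α} (hX : X.card = j) (f : Finset α → ℚ) :
    ∑ Y ∈ sups j X, f Y = ∑ y ∈ univ \ X, f (insert y X) := by
  rw [sups_eq hX, sum_image (insert_injOn X)]

/-- The number of supersets of a `j`-set in the level above is `n − j`. -/
theorem card_sups {j : ℕ} {X : Finset α} (hX : X.card = j) : (sups j X).card = Fintype.card α - j := by
  rw [sups_eq hX, card_image_of_injOn (insert_injOn X), card_univ_sdiff, hX]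

/-- The number of touched supersets of `X` (`= t(X)`, the number of code neighbours of `X` when `X ∈ P`). -/
def touchedCount (D : Finset (Finset α)) (X : Finset α) : ℕ :=
  ((univ \ X).filter (fun y => Touched D (insert y X))).card

/-- `t(X) ≤ n − j`. -/
theorem touchedCount_le {j : ℕ} {D : Finset (Finset α)} {X : Finset α} (hX : X.card = j) :
    touchedCount D X ≤ Fintype.card α - j := by
  unfold touchedCount
  calc ((univ \ X).filter (fun y => Touched D (insert y X))).card ≤ (univ \ X).card := card_filter_le _ _
    _ = Fintype.card α - j := by rw [card_univ_sdiff, hX]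

/-! ### (SP) for regular codes -/

/-- The regular weights: `1/j` on the touched pairs, `1/(j+1)` on the untouched ones (the `X`-argument is idle). -/
def regWeight (j : ℕ) (D : Finset (Finset α)) (_X Y : Finset α) : ℚ :=
  if Touched D Y then 1 / j else 1 / (j + 1)

omit [Fintype α] in
/-- The regular weights are nonnegative. -/
theorem regWeight_nonneg (j : ℕ) (D : Finset (Finset α)) (X Y : Finset α) : 0 ≤ regWeight j D X Y := by
  unfold regWeight
  split_ifs <;> positivity

/-- The column sums of the regular weights are exactly `1`. -/
theorem sum_subsP_regWeight {j : ℕ} {D : Finset (Finset α)} (hD : IsCode j D) (hj : 0 < j) {Y : Finset α}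
    (hY : Y.card = j + 1) : ∑ X ∈ subsP j D Y, regWeight j D X Y = 1 := by
  have hc := card_subsP hD hY
  unfold regWeight
  rw [sum_const, nsmul_eq_mul]
  split_ifs at hc ⊢ with ht
  · have h : (subsP j D Y).card = j := by omega
    rw [h]
    have hj' : (j : ℚ) ≠ 0 := by exact_mod_cast hj.ne'
    field_simp
  · have h : (subsP j D Y).card = j + 1 := by omega
    rw [h]
    push_cast
    field_simp

/-- The row sum of the regular weights at a `j`-set `X` is `t(X)/j + (n − j − t(X))/(j+1)`. -/
theorem sum_sups_regWeight {j : ℕ} {D : Finset (Finset α)} {X : Finset α} (hX : X.card = j) :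
    ∑ Y ∈ sups j X, regWeight j D X Y =
      (touchedCount D X : ℚ) / j + ((Fintype.card α - j - touchedCount D X : ℕ) : ℚ) / (j + 1) := by
  rw [sum_sups hX]
  unfold regWeight
  rw [sum_ite, sum_const, sum_const, nsmul_eq_mul, nsmul_eq_mul]
  have h2 : ((univ \ X).filter (fun y => ¬ Touched D (insert y X))).card = Fintype.card α - j - touchedCount D X := by
    have := card_filter_add_card_filter_not (fun y => Touched D (insert y X)) (s := univ \ X)
    rw [card_univ_sdiff, hX] at this
    unfold touchedCount
    omega
  rw [h2]
  unfold touchedCount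
  ring

/-- **(SP) for regular codes.** If every `X ∈ P` has the same number `t₀` of touched supersets, the regular weights have
constant row sums; double counting makes them `#Y / #P`, and the master lemma gives (SP). -/
theorem puncturedNMP_of_regular {j : ℕ} {D : Finset (Finset α)} (hD : IsCode j D) (hj : 0 < j) (t₀ : ℕ)
    (hreg : ∀ X ∈ punctured j D, touchedCount D X = t₀) : PuncturedNMP j D := by
  intro 𝒜 h𝒜
  set ρ : ℚ := (t₀ : ℚ) / j + ((Fintype.card α - j - t₀ : ℕ) : ℚ) / (j + 1) with hρ
  have hrowEq : ∀ X ∈ punctured j D, ∑ Y ∈ sups j X, regWeight j D X Y = ρ := by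
    intro X hX
    rw [sum_sups_regWeight (mem_punctured.1 hX).1, hreg X hX]
  have hrow : ∀ X ∈ punctured j D, ρ ≤ ∑ Y ∈ sups j X, regWeight j D X Y := fun X hX => (hrowEq X hX).ge
  have hcolEq : ∀ Y ∈ levelAbove α j, ∑ X ∈ subsP j D Y, regWeight j D X Y = 1 :=
    fun Y hY => sum_subsP_regWeight hD hj (mem_levelAbove.1 hY)
  have hcol : ∀ Y ∈ levelAbove α j, ∑ X ∈ subsP j D Y, regWeight j D X Y ≤ 1 := fun Y hY => (hcolEq Y hY).le
  -- double counting: `#P · ρ = #Y`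
  have hdc : ((punctured j D).card : ℚ) * ρ = (levelAbove α j).card := by
    calc ((punctured j D).card : ℚ) * ρ = ∑ X ∈ punctured j D, ∑ Y ∈ sups j X, regWeight j D X Y := by
          rw [card_eq_sum_ones, Nat.cast_sum, sum_mul]
          apply sum_congr rfl
          intro X hX
          rw [hrowEq X hX]
          simp
      _ = ∑ Y ∈ levelAbove α j, ∑ X ∈ subsP j D Y, regWeight j D X Y := by
          apply sum_comm'
          intro X Y
          simp only [mem_sups, mem_subsP, mem_punctured, mem_levelAbove]
          tauto
      _ = ∑ Y ∈ levelAbove α j, (1 : ℚ) := sum_congr rfl hcolEq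
      _ = (levelAbove α j).card := by simp
  have hmain := card_upNbhd_ge_of_weights (regWeight j D) ρ (regWeight_nonneg j D) hrow hcol h𝒜
  have hq : ((𝒜.card * (levelAbove α j).card : ℕ) : ℚ) ≤ ((upNbhd j 𝒜).card * (punctured j D).card : ℕ) := by
    push_cast
    rw [← hdc]
    calc (𝒜.card : ℚ) * ((punctured j D).card * ρ) = ((𝒜.card : ℚ) * ρ) * (punctured j D).card := by ring
      _ ≤ (upNbhd j 𝒜).card * (punctured j D).card := mul_le_mul_of_nonneg_right hmain (by positivity)
  exact_mod_cast hq

/-- The empty code: the classical normalised matching property (LYM) between the levels `j` and `j + 1`. -/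
theorem puncturedNMP_empty {j : ℕ} (hj : 0 < j) : PuncturedNMP j (∅ : Finset (Finset α)) := by
  refine puncturedNMP_of_regular ⟨by simp, by simp⟩ hj 0 ?_
  intro X _
  unfold touchedCount
  rw [card_eq_zero, filter_eq_empty_iff]
  rintro y _ ⟨B, hB, -⟩
  simp at hB

end PercRepro.PuncturedLYM
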